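import Mathlib
import Summits.Ventures.PercRepro2.IncReimerProof

/-!
# Asymmetric pins: the colour split of a pattern count, STEP(0,2) with a red-only pin, and the
blue-only pin as the (AS3) core (seat mine-b, cell pub-perc-repro2; conjectures/MINE-B.md §14)

For an increasing event `A` (a clutter) the pattern count `absH A O Y i j` of AS3Cases.lean pins the
set `O` on BOTH colours.  Here the pins are split: `absHA A R B Y i j` counts the configurations
`γ ⊆ Y` with `pack(R ∪ (Y \ γ)) = i` and `pack(B ∪ γ) ≥ j` — red pins `R`, blue pins `B`
(`absH_eq_absHA`: `absH` is the diagonal `R = B`).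

* `absH_insert_eq_absHA` — **the colour split**: the count of the pattern `(O, insert q Y)` is the sum of
  the count with `q` as a RED-ONLY pin and the count with `q` as a BLUE-ONLY pin.  Hence every
  monotonicity of the slack in the split set ((SPLIT-MONO), (INC-REIMER)) is a statement about these
  two asymmetric patterns (`slack_insert_eq`).
* `absHA_redPin_zero_two_le` — **STEP(0,2) holds with one red-only pin, for every clutter**:
  `#{pack(O ∪ q ∪ ρ) = 0 ∧ pack(O ∪ γ) ≥ 2} ≤ #{pack(O ∪ q ∪ ρ) = 1 ∧ pack(O ∪ γ) ≥ 1}`.  The proof is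
  Reimer for the pair `(B₀, B₁) = (A (O ∪ ·), A (O ∪ q ∪ ·))` plus one coupling: two disjoint
  members of `O ∪ q ∪ γ` contain one that avoids `q` (`dOcc_pinned_of_pinK_two_insert`), so the
  swapped defect `#{B₀ γ ∧ pack(O ∪ q ∪ ρ) ≥ 2} = #{pack(O ∪ q ∪ γ) ≥ 2 ∧ B₀ ρ}` and the sources are
  disjoint parts of `B₀ □ B₁`, which Reimer bounds by `#{B₀ γ ∧ B₁ ρ}`.
* `absHA_bluePin_zero_two_le_of_AS3` — STEP(0,2) with one BLUE-only pin follows from (AS3) for the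
  nested pair `(A (O ∪ q ∪ ·), A (O ∪ ·))` (first event bigger).  Conversely (BluePin.lean) every (AS3)
  instance with `B ⊆ A` is such a blue-pin instance, so «STEP(0,2) tolerates one blue-only pin»
  (`BluePinStep`) is EQUIVALENT to (AS3) on the nested pairs with the first event bigger — a part of
  the (AS3) conjecture of MINE-B.md §11.3, but NOT the part the i = 0 row of STEP needs: STEP(0, j) is
  (AS3)(pack ≥ j−1, pack ≥ 1) with the first event SMALLER (`stepH_zero_of_AS3`).  Two blue-only pins
  are not tolerated (two parallel members, both blue-pinned).
-/

open Finset

namespace Summit.Ventures.PercRepro2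

namespace StepZero

open ReimerCube

variable {E : Type*} [DecidableEq E]

open Classical

/-! ## The count with separate red and blue pins -/

/-- the pattern count with red pins `R` and blue pins `B`:
`#{γ ⊆ Y : pack(R ∪ (Y \ γ)) = i ∧ pack(B ∪ γ) ≥ j}` -/
noncomputable def absHA (A : Finset E → Prop) (R B Y : Finset E) (i j : ℕ) : ℕ :=
  (Y.powerset.filter (fun γ => pinK A R i (Y \ γ) ∧ ¬ pinK A R (i + 1) (Y \ γ) ∧ pinK A B j γ)).card

/-- shared pins are the diagonal case -/
theorem absH_eq_absHA (A : Finset E → Prop) (O Y : Finset E) (i j : ℕ) :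
    absH A O Y i j = absHA A O O Y i j := rfl

/-- moving a pin into the configuration -/
lemma pinK_insert_left_iff (A : Finset E → Prop) (O X : Finset E) (q : E) (k : ℕ) :
    pinK A (insert q O) k X ↔ pinK A O k (insert q X) := by
  unfold pinK
  rw [Finset.insert_union, Finset.union_insert]

/-- **The colour split**: the count of `(O, insert q Y)` is the count with `q` red-only pinned plus
the count with `q` blue-only pinned. -/
theorem absH_insert_eq_absHA (A : Finset E → Prop) (O Y : Finset E) (q : E) (hqY : q ∉ Y) (i j : ℕ) :
    absH A O (insert q Y) i j = absHA A (insert q O) O Y i j + absHA A O (insert q O) Y i j := by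
  unfold absH absHA
  rw [card_filter_powerset_insert hqY]
  have e1 : Y.powerset.filter (fun γ => pinK A O i (insert q Y \ γ) ∧
      ¬ pinK A O (i + 1) (insert q Y \ γ) ∧ pinK A O j γ)
      = Y.powerset.filter (fun γ => pinK A (insert q O) i (Y \ γ) ∧
      ¬ pinK A (insert q O) (i + 1) (Y \ γ) ∧ pinK A O j γ) := by
    apply Finset.filter_congr
    intro γ hγ
    rw [Finset.mem_powerset] at hγ
    rw [insert_sdiff_of_not_mem' hγ hqY, pinK_insert_left_iff, pinK_insert_left_iff]
  have e2 : Y.powerset.filter (fun γ => pinK A O i (insert q Y \ insert q γ) ∧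
      ¬ pinK A O (i + 1) (insert q Y \ insert q γ) ∧ pinK A O j (insert q γ))
      = Y.powerset.filter (fun γ => pinK A O i (Y \ γ) ∧
      ¬ pinK A O (i + 1) (Y \ γ) ∧ pinK A (insert q O) j γ) := by
    apply Finset.filter_congr
    intro γ _
    rw [insert_sdiff_insert' hqY, pinK_insert_left_iff]
  rw [e1, e2]

/-- the slack with red pins `R` and blue pins `B` -/
noncomputable def slackA (A : Finset E → Prop) (R B Y : Finset E) (i j : ℕ) : ℤ :=
  (absHA A R B Y (i + 1) (j - 1) : ℤ) - absHA A R B Y i j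

/-- the STEP slack of `(O, insert q Y)` is the sum of the two asymmetric slacks -/
theorem slack_insert_eq (A : Finset E → Prop) (O Y : Finset E) (q : E) (hqY : q ∉ Y) (i j : ℕ) :
    slack A O (insert q Y) i j
      = slackA A (insert q O) O Y i j + slackA A O (insert q O) Y i j := by
  unfold slack slackA
  rw [absH_insert_eq_absHA A O Y q hqY, absH_insert_eq_absHA A O Y q hqY]
  push_cast
  ring

/-! ## The coupling: two disjoint members with `q` used at most once -/

omit [DecidableEq E] in
/-- disjoint occurrence is symmetric -/
lemma dOcc_symm {A B : Finset E → Prop} {S : Finset E} (h : DOcc A B S) : DOcc B A S := by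
  obtain ⟨K, L, hK, hL, hKL, hA, hB⟩ := h
  exact ⟨L, K, hL, hK, hKL.symm, hB, hA⟩

/-- two disjoint members of `A` in `insert q O ∪ γ` (`q` used by at most one of them) give a
cube-level disjoint occurrence on `γ` of the pinned event `A (O ∪ ·)` and the `q`-pinned event
`A (insert q O ∪ ·)` -/
lemma dOcc_pinned_of_pinK_two_insert {A : Finset E → Prop} (hA : Incr A) (O : Finset E) (q : E)
    {γ : Finset E} (h : pinK A (insert q O) 2 γ) :
    DOcc (fun X => A (O ∪ X)) (fun X => A (insert q O ∪ X)) γ := by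
  have h' : DOcc A A (O ∪ insert q γ) := by
    have h2 : DOcc A (kDisj A 1) (insert q O ∪ γ) := h
    rw [Finset.insert_union, ← Finset.union_insert] at h2
    exact DOcc.mono_right (fun T hT => (kDisj_one_iff hA T).mp hT) h2
  have e : ∀ X, insert q O ∪ X = O ∪ insert q X := fun X => by
    rw [Finset.insert_union, Finset.union_insert]
  rcases dOcc_pinned_insert O q γ h' with h1 | h1
  · refine DOcc.mono_right (fun T hT => ?_) h1
    rw [e]; exact hT
  · refine dOcc_symm (DOcc.mono_left (fun T hT => ?_) h1)
    rw [e]; exact hT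

/-- the colour swap `γ ↦ Y \ γ` on a two-sided count -/
lemma card_filter_swap (P Q : Finset E → Prop) (Y : Finset E) :
    (Y.powerset.filter (fun γ => P γ ∧ Q (Y \ γ))).card
      = (Y.powerset.filter (fun γ => Q γ ∧ P (Y \ γ))).card := by
  apply Finset.card_nbij' (fun γ => Y \ γ) (fun γ => Y \ γ)
  · intro γ hγ
    rw [Finset.coe_filter] at hγ ⊢
    obtain ⟨hY, h1, h2⟩ := hγ
    rw [Finset.mem_powerset] at hY
    refine ⟨Finset.mem_powerset.mpr Finset.sdiff_subset, h2, ?_⟩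
    rw [Finset.sdiff_sdiff_eq_self hY]
    exact h1
  · intro γ hγ
    rw [Finset.coe_filter] at hγ ⊢
    obtain ⟨hY, h1, h2⟩ := hγ
    rw [Finset.mem_powerset] at hY
    refine ⟨Finset.mem_powerset.mpr Finset.sdiff_subset, h2, ?_⟩
    rw [Finset.sdiff_sdiff_eq_self hY]
    exact h1
  · intro γ hγ
    rw [Finset.coe_filter] at hγ
    exact Finset.sdiff_sdiff_eq_self (Finset.mem_powerset.mp hγ.1)
  · intro γ hγ
    rw [Finset.coe_filter] at hγ
    exact Finset.sdiff_sdiff_eq_self (Finset.mem_powerset.mp hγ.1)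

/-! ## STEP(0,2) with one red-only pin -/

/-- **STEP(0,2) with one red-only pin, for every increasing event**:
`#{γ ⊆ Y : pack(insert q O ∪ (Y \ γ)) = 0 ∧ pack(O ∪ γ) ≥ 2}
  ≤ #{γ ⊆ Y : pack(insert q O ∪ (Y \ γ)) = 1 ∧ pack(O ∪ γ) ≥ 1}`. -/
theorem absHA_redPin_zero_two_le {A : Finset E → Prop} (hA : Incr A) (O Y : Finset E) (q : E) :
    absHA A (insert q O) O Y 0 2 ≤ absHA A (insert q O) O Y 1 1 := by
  set B₀ : Finset E → Prop := fun X => A (O ∪ X) with hB₀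
  set B₁ : Finset E → Prop := fun X => A (insert q O ∪ X) with hB₁
  have iB₀ : Incr B₀ := fun _ _ h hS => hA (Finset.union_subset_union_right h) hS
  have iB₁ : Incr B₁ := fun _ _ h hS => hA (Finset.union_subset_union_right h) hS
  have hB01 : ∀ S, B₀ S → B₁ S := fun S h =>
    hA (Finset.union_subset_union_left (Finset.subset_insert q O)) h
  -- the sources lie in `B₀ □ B₁ ∧ ¬ B₁ ρ`
  have hS : absHA A (insert q O) O Y 0 2
      ≤ (Y.powerset.filter (fun γ => DOcc B₀ B₁ γ ∧ ¬ B₁ (Y \ γ))).card := by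
    unfold absHA
    apply Finset.card_le_card
    intro γ hγ
    rw [Finset.mem_filter] at hγ ⊢
    obtain ⟨hY, -, h1, h2⟩ := hγ
    refine ⟨hY, DOcc.mono_right hB01 (dOcc_pinned_of_pinK_two hA O h2), ?_⟩
    rw [pinK_one_iff hA] at h1
    exact h1
  -- the swapped defect lies in `B₀ □ B₁ ∧ B₁ ρ`
  have hX : (Y.powerset.filter (fun γ => pinK A (insert q O) 2 γ ∧ B₀ (Y \ γ))).card
      ≤ (Y.powerset.filter (fun γ => DOcc B₀ B₁ γ ∧ B₁ (Y \ γ))).card := by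
    apply Finset.card_le_card
    intro γ hγ
    rw [Finset.mem_filter] at hγ ⊢
    exact ⟨hγ.1, dOcc_pinned_of_pinK_two_insert hA O q hγ.2.1, hB01 _ hγ.2.2⟩
  -- the two parts of `B₀ □ B₁`
  have hsum : (Y.powerset.filter (fun γ => DOcc B₀ B₁ γ ∧ B₁ (Y \ γ))).card
      + (Y.powerset.filter (fun γ => DOcc B₀ B₁ γ ∧ ¬ B₁ (Y \ γ))).card
      = (Y.powerset.filter (fun γ => DOcc B₀ B₁ γ)).card := by
    rw [← Finset.card_filter_add_card_filter_not (fun γ => B₁ (Y \ γ))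
      (s := Y.powerset.filter (fun γ => DOcc B₀ B₁ γ)), Finset.filter_filter, Finset.filter_filter]
  -- Reimer for the pair `(B₀, B₁)`
  have hR := reimer_increasing Y B₀ B₁ iB₀ iB₁
  -- the targets are `#{B₀ γ ∧ B₁ ρ}` minus the defect `#{B₀ γ ∧ pack(insert q O ∪ ρ) ≥ 2}`
  have hT : absHA A (insert q O) O Y 1 1
      + (Y.powerset.filter (fun γ => B₀ γ ∧ pinK A (insert q O) 2 (Y \ γ))).card
      = (Y.powerset.filter (fun γ => B₀ γ ∧ B₁ (Y \ γ))).card := by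
    rw [← Finset.card_filter_add_card_filter_not (fun γ => pinK A (insert q O) 2 (Y \ γ))
      (s := Y.powerset.filter (fun γ => B₀ γ ∧ B₁ (Y \ γ))), Finset.filter_filter,
      Finset.filter_filter, Nat.add_comm]
    congr 1
    · apply congrArg Finset.card
      apply Finset.filter_congr
      intro γ _
      constructor
      · rintro ⟨h1, h2⟩
        refine ⟨⟨h1, ?_⟩, h2⟩
        exact (pinK_one_iff hA _ _).mp (pinK_of_succ A (insert q O) 1 h2)
      · rintro ⟨⟨h1, -⟩, h2⟩; exact ⟨h1, h2⟩
    · unfold absHA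
      apply congrArg Finset.card
      apply Finset.filter_congr
      intro γ _
      rw [pinK_one_iff hA, pinK_one_iff hA]
      constructor
      · rintro ⟨h1, h2, h3⟩; exact ⟨⟨h3, h1⟩, h2⟩
      · rintro ⟨⟨h3, h1⟩, h2⟩; exact ⟨h1, h2, h3⟩
  -- the swap
  have hsw : (Y.powerset.filter (fun γ => B₀ γ ∧ pinK A (insert q O) 2 (Y \ γ))).card
      = (Y.powerset.filter (fun γ => pinK A (insert q O) 2 γ ∧ B₀ (Y \ γ))).card :=
    card_filter_swap B₀ (pinK A (insert q O) 2) Y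
  omega

/-! ## The blue-only pin: the (AS3) core -/

/-- **(BP): STEP(0,2) with one blue-only pin** — `#{γ ⊆ Y : pack(O ∪ (Y \ γ)) = 0 ∧
pack(insert q O ∪ γ) ≥ 2} ≤ #{γ ⊆ Y : pack(O ∪ (Y \ γ)) = 1 ∧ pack(insert q O ∪ γ) ≥ 1}` for every
pattern; for every clutter it is EQUIVALENT to (AS3) for all nested pairs with the first event bigger
(`B ⊆ A`; BluePin.lean, MINE-B.md §14 with its CORRECTION).  It does not cover the pairs
`(pack ≥ j−1, pack ≥ 1)` of the i = 0 STEP row, whose first event is the smaller one. -/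
def BluePinStep (A : Finset E → Prop) : Prop :=
  ∀ (O Y : Finset E) (q : E), q ∉ O → q ∉ Y →
    absHA A O (insert q O) Y 0 2 ≤ absHA A O (insert q O) Y 1 1

/-- (BP) at a pattern follows from (AS3) for the nested pair `(A (insert q O ∪ ·), A (O ∪ ·))` on
the cube `Y`. -/
theorem absHA_bluePin_zero_two_le_of_AS3 {A : Finset E → Prop} (hA : Incr A) (O Y : Finset E)
    (q : E) (h : AS3 Y (fun X => A (insert q O ∪ X)) (fun X => A (O ∪ X))) :
    absHA A O (insert q O) Y 0 2 ≤ absHA A O (insert q O) Y 1 1 := by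
  unfold AS3 at h
  refine le_trans (le_trans ?_ h) ?_
  · unfold absHA
    apply Finset.card_le_card
    intro γ hγ
    rw [Finset.mem_filter] at hγ ⊢
    obtain ⟨hY, -, h1, h2⟩ := hγ
    refine ⟨hY, dOcc_symm (dOcc_pinned_of_pinK_two_insert hA O q h2), ?_⟩
    rw [pinK_one_iff hA] at h1
    exact h1
  · unfold absHA
    apply Finset.card_le_card
    intro γ hγ
    rw [Finset.mem_filter] at hγ ⊢
    obtain ⟨hY, h1, h2, h3⟩ := hγ
    refine ⟨hY, (pinK_one_iff hA _ _).mpr h2, fun h4 => h3 (dOcc_pinned_of_pinK_two hA O h4),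
      (pinK_one_iff hA _ _).mpr h1⟩

/-- (BP) for every pattern of `A` follows from (AS3) for all its nested pinned pairs. -/
theorem bluePinStep_of_AS3 {A : Finset E → Prop} (hA : Incr A)
    (h : ∀ (O Y : Finset E) (q : E), q ∉ O → q ∉ Y →
      AS3 Y (fun X => A (insert q O ∪ X)) (fun X => A (O ∪ X))) :
    BluePinStep A :=
  fun O Y q hqO hqY => absHA_bluePin_zero_two_le_of_AS3 hA O Y q (h O Y q hqO hqY)

end StepZero

end Summit.Ventures.PercRepro2
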